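import Literature.MathematicalPhysics.QuantumFieldTheory.Balaban1983to89.T4InputCauchyRateTermwise

/-!
# OutputRateOpHolomorphic — the OPERATOR half of wall W2 of binder row NE5 (node U3) DISCHARGED BY STRUCTURE: the termwise
# operator-line analyticity `TermOpLineAnalytic` ⟸ «every term of the one-step expansion is a DOMINATED HOLOMORPHIC PARAMETRIC
# INTEGRAL of the operator datum» (cell `pub-balaban`, T⁴ fan-out, `HOME/BINDER-OWNERS.md` row NE5, owner lineage t4-ne5-p1,
# gen 28, route P1 «input-interpolation Cauchy rate»; LEAN PLACEMENT RULE 2026-08-19: our work under `Summits/`)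

HONEST FRAMING (T4-DAG PAGE 1).  The cell's T⁴ target is rung (B)+1: existence AND uniqueness of the ε → 0 limit of Bałaban's
unit-scale averaged gauge-invariant expectations on a FIXED finite torus T⁴ — NOT infinite volume, NOT a mass gap, NOT the Clay
problem; the spine's conditionals (`FlowStep.BetaPertH`, (B), (B^μ)) do not occur in this module and are NOT hidden here.  The
spine estimate NE5 (shape `T4OutputRate.NE5`) is NOT PRINTED in [Balaban1987RG1]–[Balaban1989LargeFieldII] (ε-UNIFORM BOUNDS are
printed, never two-spacing RATES; cell GAPS G-t4-U3-1) and is NOT PROVED here or anywhere in the tree; spine estimates PROVED: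
0/9, unchanged.  Nothing printed is asserted and no print quotation is introduced (0 cite tags; the located print behind the
operator species — [II] = [Balaban1988RG2Cluster] p. 3 (1.5) «we can replace the propagators by arbitrary operators having the
same regularity properties and satisfying the same bounds», p. 5 (analyticity of `H(s(Y₀))` on `|s| ≤ e^{κ₁}`), p. 15 (2.14) and
«This complicates estimates of this expression, because the operators in it are not symmetric, and the second measure is
complex.  The general case is handled by a perturbative argument.» (2.15)–(2.17) p. 16 — is quoted verbatim in the imported
Literature leaves `T4InputCauchyRateData` §11 / `T4InputCauchyRateTermwise` and in the lineage record `t4/T4-EST-NE5-P1.md`).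
HONEST DEPENDENCY (cell, verbatim): continuum YM on T⁴ ⇐ BetaPertH ∧ nine spine estimates (0/9 proved); BetaPertH ⇐ (D1) ∧ (D4)
∧ CAP+tail; G-an2-4 gates asym, D1 and NE2/3/4.

WHAT THIS MODULE IS.  Route P1 reduces NE5 to the walls W1 (`OperatorRate`) ∧ W2 ∧ W3 ∧ W4 ∧ MI-R ∧ S ∧ R; the TERMWISE layer
(`T4InputCauchyRateTermwise` v1.2) consumes W2 as `TermRep ∧ TermBound ∧ TermBudget` (the convergent expansion (2.13) with its
termwise majorants) ∧ `TermOpLineAnalytic` (operator species) ∧ `TermHistLineAnalytic` (history species).  The HISTORY species was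
discharged BY STRUCTURE in v1.2 (`termHistLineAnalytic_of_expLinear` ⟸ `TermHistExpLinear`: terms `∫ Φ(a)·exp(Λ(a) h) dμ(a)`);
for the OPERATOR species the leaf says verbatim «no structural form is claimed here» — `TermOpLineAnalytic` stayed an [analysis]
HYPOTHESIS (walls sheet `WALLS-NE5-P1.md` v16 row W2-op, cell GAPS G-ne5p1-1″ operator half).  THIS MODULE supplies the
structural form for the operator species, by the route's own technique (analytic dependence on the inputs ⟹ Cauchy estimates),
with the several-complex-variables engine imported BY NAME (`Literature.Analysis.Complex.differentiableOn_integral_of_dominated`: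
integrals of holomorphic families with a locally uniform integrable majorant are holomorphic in the parameter — NO hypothesis on
the derivative):
* §1 ENGINE ALONG A LINE: `differentiableOn_integral_lineMap_of_dominated` — a dominated holomorphic parametric integral of the
  operator datum, restricted to a complex operator line `ζ ↦ o + ζu` inside the holomorphy domain, is complex differentiable
  there; `norm_integral_le_of_majorant` (the integral is bounded by the majorant's mass).
* §2 THE STRUCTURAL SHAPE `TermOpHolomorphic K T W μ f 𝒪`: on the history fibres of the class, EVERY TERM `T k i o h X` of the
  expansion is, for operator data `o` in an operator domain `𝒪 k g U h ⊇` (the class's operator fibre at `h`), the integral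
  `∫ f k i h X o a dμ(a)` of an integrand HOLOMORPHIC in `o` on `𝒪`, a.e.-strongly measurable in `a`, with a LOCALLY UNIFORM
  INTEGRABLE MAJORANT; **`termOpLineAnalytic_of_opHolomorphic`: `TermOpHolomorphic ⟹ TermOpLineAnalytic`** (STRUCTURE ⟹ LINE,
  operator species — the mirror image of `termHistLineAnalytic_of_expLinear`); `termBound_of_opHolomorphic_majorant` (the SAME
  representation with a budgeted majorant gives `TermBound`).
* §3 THE BALL FORM `TermOpHolomorphicBall ctr RHist R′ μ f` on the lineage's `ballClass ctr ROp RHist` (holomorphy and ONE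
  integrable majorant on the open operator ball of radius `R′ k > ROp k` around the class centre) ⟹ `TermOpHolomorphic`
  (`termOpHolomorphic_of_ball`).
* §4 END FACES WITH BOTH SPECIES STRUCTURAL — `ne5_at_of_stepModel_termwise_biStructural_scale_nat` (= the leaf's
  `ne5_at_of_stepModel_termwise_expLinear_scale_nat` with its LAST [analysis] binder `hlineOp : TermOpLineAnalytic` replaced by
  `TermOpHolomorphic`; SAME smallness `ω + G·c/(1 − ρ₀) < θ′`, SAME constant) and its ball-class/budget form
  `ne5_at_of_stepModel_termwise_biStructural_budget_scale_nat`; both conclude `T4OutputRate.NE5` LITERALLY.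
* §5 OUTPUT-LEVEL FACE (no series): `opFibreEnvelope_of_outHolomorphic` — a step model whose OUTPUT itself is a dominated
  holomorphic integral of the operator datum on open sets containing the operator boxes, with a budgeted majorant, satisfies the
  leaf's `StepModel.OpFibreEnvelope W κ G` (W2-op in its original currency).
* NON-VACUITY is the sibling module `OutputRateOpHolomorphicWitness` (the COMPLEX-GAUSSIAN TOY TERM `∫_ℝ exp(−(1 + o)x²) dx` — a
  Gaussian integral whose complex covariance IS the operator datum `o ∈ ℂ`, the one-dimensional shadow of (2.14)'s
  `∫dμ_{C^{(k)}(σ)}(B)` with non-symmetric operators and a complex measure — satisfies `TermOpHolomorphicBall` with room `R′ = 1/2`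
  and majorant `e^{−x²/2}`, hence `TermOpLineAnalytic` and `TermBound` with weight `√(2π)` on the ball class of radii `(1/4, 1)`).

STATUS OF THE RE-TYPED WALL (census; Edison rule: every variant stated with exactly what remains).  NOT A PROOF OF W2-op FOR
BAŁABAN'S (2.14): the wall is RELOCATED from «analyticity of each term along complex operator lines» ([analysis], no structure)
to the CONJUNCTION of (H-rep) a termwise integral REPRESENTATION against operator-independent reference measures (dictionary: the
Gaussian measures of (2.14) written as densities, the `σ(Δ)`/`τ(Y)` contour and `s`/`t` interpolation integrals as product
measures), (H-hol) HOLOMORPHY OF THE INTEGRAND in the operator datum (algebraic: the integrand of (2.14) is built from the operators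
by products, inverses, square roots near positive operators and exponentials), (H-meas) measurability, and (H-dom) a LOCALLY UNIFORM
INTEGRABLE (Gaussian) MAJORANT on the operator domain — the one analytic input, of the printed KIND of the operator-replacement
estimates (2.15)–(2.17) p. 16 of [II] (domination of the complex-measure integrand after replacing the operators), NOT PRINTED as a
statement over an operator ball.  Every other wall of the row (W1, W2-hist structural data, W2-ins, W3, W4 produced, MI-R, S, R) is
consumed BY NAME and unchanged; no wall is discharged from print; S and the exponent are untouched (W2-op is CONSTANT-only
downstream: it enters `G`).  NE5 NOT PRINTED / NOT PROVED; spine 0/9; rung (B)+1 finite T⁴ only; NOT infinite volume / mass gap /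
Clay.  0 sorry; axioms ⊆ {propext, Classical.choice, Quot.sound}.
-/

noncomputable section

open Set Metric MeasureTheory Filter

namespace Summit.QuantumFields.BalabanUV.T4Continuum.OutputRateOpHolomorphic

open Literature.MathematicalPhysics.QuantumFieldTheory.Balaban1983to89
open Literature.MathematicalPhysics.QuantumFieldTheory.Balaban1983to89.T4OutputRate
open Literature.MathematicalPhysics.QuantumFieldTheory.Balaban1983to89.T4InputCauchyRate
open Literature.MathematicalPhysics.QuantumFieldTheory.Balaban1983to89.T4InputCauchyRateData
open Literature.MathematicalPhysics.QuantumFieldTheory.Balaban1983to89.T4InputCauchyRateSpecies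
open Literature.MathematicalPhysics.QuantumFieldTheory.Balaban1983to89.T4InputCauchyRateTermwise

/-! ## §1 The engine along a complex operator line -/

section Engine

variable {Op : Type*} [NormedAddCommGroup Op] [NormedSpace ℂ Op] {α : Type*} [MeasurableSpace α]

/-- **THE ENGINE ALONG A LINE.**  If `f o a` is a.e.-strongly measurable in `a` for every operator datum `o` of a domain `𝒪`,
holomorphic in `o` on `𝒪` for a.e. `a`, and every point of `𝒪` has a ball in `𝒪` on which `‖f o a‖ ≤ bound a` with an integrable
`bound`, then along every complex operator line `ζ ↦ o + ζ•u` mapping a set `S ⊆ ℂ` into `𝒪` the parametric integral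
`ζ ↦ ∫ f (o + ζ•u) a dμ` is complex differentiable on `S` — `Literature.Analysis.Complex.differentiableOn_integral_of_dominated`
(holomorphy of dominated parameter integrals, NO hypothesis on the derivative) composed with the affine line map. [folklore] -/
theorem differentiableOn_integral_lineMap_of_dominated {μ : Measure α} {f : Op → α → ℂ} {𝒪 : Set Op}
    (hmeas : ∀ o ∈ 𝒪, AEStronglyMeasurable (f o) μ) (hdiff : ∀ᵐ a ∂μ, DifferentiableOn ℂ (fun o => f o a) 𝒪)
    (hdom : ∀ o₀ ∈ 𝒪, ∃ R : ℝ, 0 < R ∧ ball o₀ R ⊆ 𝒪 ∧ ∃ bound : α → ℝ, Integrable bound μ ∧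
      ∀ᵐ a ∂μ, ∀ o ∈ ball o₀ R, ‖f o a‖ ≤ bound a)
    (o u : Op) {S : Set ℂ} (hS : MapsTo (fun ζ : ℂ => o + ζ • u) S 𝒪) :
    DifferentiableOn ℂ (fun ζ : ℂ => ∫ a, f (o + ζ • u) a ∂μ) S :=
  (Literature.Analysis.Complex.differentiableOn_integral_of_dominated hmeas hdiff hdom).comp
    (by fun_prop : Differentiable ℂ fun ζ : ℂ => o + ζ • u).differentiableOn hS

omit [NormedSpace ℂ Op] in
/-- The integral of a dominated integrand is bounded by the mass of its majorant (Mathlib's `norm_integral_le_of_norm_le`, in the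
module's notation). [folklore] -/
theorem norm_integral_le_of_majorant {μ : Measure α} {φ : α → ℂ} {bound : α → ℝ} (hbound : Integrable bound μ)
    (hle : ∀ᵐ a ∂μ, ‖φ a‖ ≤ bound a) : ‖∫ a, φ a ∂μ‖ ≤ ∫ a, bound a ∂μ :=
  norm_integral_le_of_norm_le hbound hle

omit [NormedSpace ℂ Op] in
/-- A ball around any point of an open ball, of radius the distance to its rim, stays inside. [folklore] -/
theorem ball_subset_ball_of_mem {c o₀ : Op} {R' : ℝ} (ho₀ : o₀ ∈ ball c R') :
    0 < R' - dist o₀ c ∧ ball o₀ (R' - dist o₀ c) ⊆ ball c R' :=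
  ⟨sub_pos.2 (mem_ball.1 ho₀), ball_subset_ball' (by linarith)⟩

end Engine

/-! ## §2 The structural shape on the termwise layer and STRUCTURE ⟹ LINE for the operator species -/

section Structural

variable {C : Carriers} {Op Hist : Type*} [NormedAddCommGroup Op] [NormedSpace ℂ Op] [NormedAddCommGroup Hist]
  [NormedSpace ℂ Hist] {ι : Type*} (K : ℕ → (ℕ → ℝ) → C.BgB → Set (Op × Hist)) (T : ℕ → ι → Op → Hist → C.Dom → ℂ)

/-- STRUCTURAL SHAPE `TermOpHolomorphic K T W μ f 𝒪` — the OPERATOR-species twin of the leaf's `TermHistExpLinear` (our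
dictionary for the printed STRUCTURE of the resummed term (2.14) p. 15 of [II]: a product of Cauchy-kernel contour integrals in
`σ(Δ)`, `τ(Y)`, interpolation integrals in `s`, `t`, and two Gaussian integrals in the auxiliary fields with characteristic
functions and the factor `exp[Σ τ(Y)𝐕_k(Y,B)]`, in which the step's OPERATORS enter through the quadratic forms, the covariance
and the localized potentials — written against operator-INDEPENDENT reference measures, the Gaussian normalisations being part of
the integrand; NOT PRINTED as a statement over an input class, [analysis]): on every HISTORY FIBRE of the class (history data `h`
carried by some class point at step `k`), there is an operator domain `𝒪 k g U h` containing the class's operator fibre at `h`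
such that, at every step-`k` domain `X` and for every term index `i`, the integrand `f k i h X o a` is a.e.-strongly measurable in
`a` for `o ∈ 𝒪`, HOLOMORPHIC in `o` on `𝒪` for a.e. `a`, LOCALLY UNIFORMLY DOMINATED on `𝒪` by integrable majorants, and the term
IS its integral: `T k i o h X = ∫ f k i h X o a dμ` for `o ∈ 𝒪` (the measure `μ k i h X` may depend on everything but the
operator datum). [folklore] -/
def TermOpHolomorphic (W : Set (ℕ → ℝ)) {α : ℕ → ι → Type*} [∀ k i, MeasurableSpace (α k i)]
    (μ : ∀ k i, Hist → C.Dom → Measure (α k i)) (f : ∀ k i, Hist → C.Dom → Op → α k i → ℂ)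
    (𝒪 : ℕ → (ℕ → ℝ) → C.BgB → Hist → Set Op) : Prop :=
  ∀ k, ∀ g ∈ W, ∀ (U : C.BgB) (h : Hist), (∃ o : Op, (o, h) ∈ K k g U) →
    (∀ o : Op, (o, h) ∈ K k g U → o ∈ 𝒪 k g U h) ∧
      ∀ X : C.Dom, C.scale X = k → ∀ i,
        (∀ o ∈ 𝒪 k g U h, AEStronglyMeasurable (f k i h X o) (μ k i h X)) ∧
        (∀ᵐ a ∂(μ k i h X), DifferentiableOn ℂ (fun o => f k i h X o a) (𝒪 k g U h)) ∧
        (∀ o₀ ∈ 𝒪 k g U h, ∃ R : ℝ, 0 < R ∧ ball o₀ R ⊆ 𝒪 k g U h ∧ ∃ bound : α k i → ℝ,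
            Integrable bound (μ k i h X) ∧ ∀ᵐ a ∂(μ k i h X), ∀ o ∈ ball o₀ R, ‖f k i h X o a‖ ≤ bound a) ∧
        (∀ o ∈ 𝒪 k g U h, T k i o h X = ∫ a, f k i h X o a ∂(μ k i h X))

variable {K T}

omit [NormedAddCommGroup Hist] [NormedSpace ℂ Hist] in
/-- **STRUCTURE ⟹ LINE, OPERATOR SPECIES** (this module's point; the mirror image of the leaf's
`termHistLineAnalytic_of_expLinear`): terms that are dominated holomorphic parametric integrals of the operator datum are complex
differentiable on the closed unit disc along every complex OPERATOR segment whose closed unit part lies in the class — the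
segment's points are class points with the SAME history datum `h`, hence lie in the operator domain `𝒪 k g U h`, on which
`o ↦ ∫ f k i h X o a dμ` is holomorphic (§1) and coincides with the term.  No strip, no room, no hypothesis of analyticity on the
operator species is left: `TermOpHolomorphic K T W μ f 𝒪 ⟹ TermOpLineAnalytic K T W`. [folklore] -/
theorem termOpLineAnalytic_of_opHolomorphic {W : Set (ℕ → ℝ)} {α : ℕ → ι → Type*} [∀ k i, MeasurableSpace (α k i)]
    {μ : ∀ k i, Hist → C.Dom → Measure (α k i)} {f : ∀ k i, Hist → C.Dom → Op → α k i → ℂ}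
    {𝒪 : ℕ → (ℕ → ℝ) → C.BgB → Hist → Set Op} (hhol : TermOpHolomorphic K T W μ f 𝒪) : TermOpLineAnalytic K T W := by
  intro k g hg U o u h hseg X hX i
  have h0 : (o, h) ∈ K k g U := by simpa only [zero_smul, add_zero] using hseg 0 (mem_closedBall_self zero_le_one)
  obtain ⟨hKO, hX'⟩ := hhol k g hg U h ⟨o, h0⟩
  obtain ⟨hmeas, hdiff, hdom, hrepr⟩ := hX' X hX i
  have hS : MapsTo (fun ζ : ℂ => o + ζ • u) (closedBall (0 : ℂ) 1) (𝒪 k g U h) := fun ζ hζ => hKO _ (hseg ζ hζ)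
  exact (differentiableOn_integral_lineMap_of_dominated hmeas hdiff hdom o u hS).congr fun ζ hζ => hrepr _ (hS hζ)

omit [NormedAddCommGroup Hist] [NormedSpace ℂ Hist] in
/-- **THE SAME REPRESENTATION WITH A BUDGETED MAJORANT GIVES `TermBound`**: if at every class point `q` and step-`k` domain `X`
the integrand of term `i` at `q` is dominated by an integrable `bd` with `∫ bd ≤ a k i · e^{−κd(X)}`, then
`TermBound K T W κ a` — the termwise majorants of [II] p. 20/21 in the integral currency (weight × decay factor = the MASS of
the dominating function). [folklore] -/
theorem termBound_of_opHolomorphic_majorant {W : Set (ℕ → ℝ)} {α : ℕ → ι → Type*} [∀ k i, MeasurableSpace (α k i)]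
    {μ : ∀ k i, Hist → C.Dom → Measure (α k i)} {f : ∀ k i, Hist → C.Dom → Op → α k i → ℂ}
    {𝒪 : ℕ → (ℕ → ℝ) → C.BgB → Hist → Set Op} (hhol : TermOpHolomorphic K T W μ f 𝒪) {κ : ℝ} {a : ℕ → ι → ℝ}
    (hmaj : ∀ k, ∀ g ∈ W, ∀ (U : C.BgB) (q : Op × Hist), q ∈ K k g U → ∀ X : C.Dom, C.scale X = k → ∀ i,
      ∃ bd : α k i → ℝ, Integrable bd (μ k i q.2 X) ∧ (∀ᵐ a ∂(μ k i q.2 X), ‖f k i q.2 X q.1 a‖ ≤ bd a) ∧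
        ∫ a, bd a ∂(μ k i q.2 X) ≤ a k i * Real.exp (-(κ * C.d X))) :
    TermBound K T W κ a := by
  intro k g hg U q hq X hX i
  obtain ⟨hKO, hX'⟩ := hhol k g hg U q.2 ⟨q.1, hq⟩
  obtain ⟨-, -, -, hrepr⟩ := hX' X hX i
  obtain ⟨bd, hbdi, hle, hbud⟩ := hmaj k g hg U q hq X hX i
  rw [hrepr q.1 (hKO q.1 hq)]
  exact (norm_integral_le_of_majorant hbdi hle).trans hbud

end Structural

/-! ## §3 The ball form on the lineage's ball class -/

section Ball

variable {C : Carriers} {Op Hist : Type*} [NormedAddCommGroup Op] [NormedSpace ℂ Op] [NormedAddCommGroup Hist]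
  [NormedSpace ℂ Hist] {ι : Type*} (T : ℕ → ι → Op → Hist → C.Dom → ℂ)

/-- STRUCTURAL SHAPE `TermOpHolomorphicBall T W ctr RHist R′ μ f` — the BALL FORM of `TermOpHolomorphic` for the lineage's
`ballClass ctr ROp RHist` (the natural instance for [II]: the operator box of (1.5)/(1.7)-bounded operators around the step's own
operators, with ROOM `R′ k > ROp k` = a slightly larger complex operator ball on which the constructions stay holomorphic with ONE
integrable majorant — the printed KIND of the `|s| ≤ e^{κ₁}` room of p. 5; NOT PRINTED as a statement, [analysis]): for every
history datum of the class's history ball, every step-`k` domain and every term index, on the OPEN operator ball of radius `R′ k`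
around the class centre the integrand is a.e.-strongly measurable, holomorphic in the operator datum for a.e. `a`, dominated by ONE
integrable majorant, and integrates to the term. [folklore] -/
def TermOpHolomorphicBall (W : Set (ℕ → ℝ)) (ctr : ℕ → (ℕ → ℝ) → C.BgB → Op × Hist) (RHist R' : ℕ → ℝ)
    {α : ℕ → ι → Type*} [∀ k i, MeasurableSpace (α k i)] (μ : ∀ k i, Hist → C.Dom → Measure (α k i))
    (f : ∀ k i, Hist → C.Dom → Op → α k i → ℂ) : Prop :=
  ∀ k, ∀ g ∈ W, ∀ (U : C.BgB), ∀ h ∈ closedBall (ctr k g U).2 (RHist k), ∀ X : C.Dom, C.scale X = k → ∀ i,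
    (∀ o ∈ ball (ctr k g U).1 (R' k), AEStronglyMeasurable (f k i h X o) (μ k i h X)) ∧
    (∀ᵐ a ∂(μ k i h X), DifferentiableOn ℂ (fun o => f k i h X o a) (ball (ctr k g U).1 (R' k))) ∧
    (∃ bound : α k i → ℝ, Integrable bound (μ k i h X) ∧
        ∀ᵐ a ∂(μ k i h X), ∀ o ∈ ball (ctr k g U).1 (R' k), ‖f k i h X o a‖ ≤ bound a) ∧
    (∀ o ∈ ball (ctr k g U).1 (R' k), T k i o h X = ∫ a, f k i h X o a ∂(μ k i h X))

variable {T}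

omit [NormedSpace ℂ Hist] in
/-- **BALL FORM ⟹ STRUCTURAL SHAPE**: with room `ROp k < R′ k` the ball form gives `TermOpHolomorphic` on `ballClass ctr ROp RHist`
with operator domains the open balls `ball (ctr k g U).1 (R′ k)` (a class point's operator datum lies in the closed ball of radius
`ROp k`, inside the open ball; local domination by the one majorant on the sub-ball reaching the rim). [folklore] -/
theorem termOpHolomorphic_of_ball {W : Set (ℕ → ℝ)} {ctr : ℕ → (ℕ → ℝ) → C.BgB → Op × Hist} {ROp RHist R' : ℕ → ℝ}
    {α : ℕ → ι → Type*} [∀ k i, MeasurableSpace (α k i)] {μ : ∀ k i, Hist → C.Dom → Measure (α k i)}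
    {f : ∀ k i, Hist → C.Dom → Op → α k i → ℂ} (hroom : ∀ k, ROp k < R' k)
    (hball : TermOpHolomorphicBall T W ctr RHist R' μ f) :
    TermOpHolomorphic (ballClass ctr ROp RHist) T W μ f fun k g U _ => ball (ctr k g U).1 (R' k) := by
  intro k g hg U h hfib
  have hKO : ∀ o : Op, (o, h) ∈ ballClass ctr ROp RHist k g U → o ∈ ball (ctr k g U).1 (R' k) := fun o ho =>
    mem_ball.2 (lt_of_le_of_lt (mem_closedBall.1 (Set.mem_prod.1 ho).1) (hroom k))
  obtain ⟨o₁, ho₁⟩ := hfib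
  have hh : h ∈ closedBall (ctr k g U).2 (RHist k) := (Set.mem_prod.1 ho₁).2
  refine ⟨hKO, fun X hX i => ?_⟩
  obtain ⟨hmeas, hdiff, ⟨bound, hbi, hble⟩, hrepr⟩ := hball k g hg U h hh X hX i
  refine ⟨hmeas, hdiff, fun o₀ ho₀ => ?_, hrepr⟩
  obtain ⟨hRpos, hsub⟩ := ball_subset_ball_of_mem ho₀
  exact ⟨_, hRpos, hsub, bound, hbi, by filter_upwards [hble] with a ha o ho using ha o (hsub ho)⟩

omit [NormedSpace ℂ Hist] in
/-- **BALL FORM ⟹ `TermOpLineAnalytic` ON THE BALL CLASS** (§2 ∘ §3). [folklore] -/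
theorem termOpLineAnalytic_of_ball {W : Set (ℕ → ℝ)} {ctr : ℕ → (ℕ → ℝ) → C.BgB → Op × Hist} {ROp RHist R' : ℕ → ℝ}
    {α : ℕ → ι → Type*} [∀ k i, MeasurableSpace (α k i)] {μ : ∀ k i, Hist → C.Dom → Measure (α k i)}
    {f : ∀ k i, Hist → C.Dom → Op → α k i → ℂ} (hroom : ∀ k, ROp k < R' k)
    (hball : TermOpHolomorphicBall T W ctr RHist R' μ f) : TermOpLineAnalytic (ballClass ctr ROp RHist) T W :=
  termOpLineAnalytic_of_opHolomorphic (termOpHolomorphic_of_ball hroom hball)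

omit [NormedSpace ℂ Hist] in
/-- **BALL FORM WITH A BUDGETED MAJORANT ⟹ `TermBound` ON THE BALL CLASS**: if the one majorant of term `i` at history datum `h`
has mass `≤ a k i · e^{−κd(X)}`, the termwise bound holds at every class point. [folklore] -/
theorem termBound_of_ball_majorant {W : Set (ℕ → ℝ)} {ctr : ℕ → (ℕ → ℝ) → C.BgB → Op × Hist} {ROp RHist R' : ℕ → ℝ}
    {α : ℕ → ι → Type*} [∀ k i, MeasurableSpace (α k i)] {μ : ∀ k i, Hist → C.Dom → Measure (α k i)}
    {f : ∀ k i, Hist → C.Dom → Op → α k i → ℂ} (hroom : ∀ k, ROp k < R' k)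
    (hball : TermOpHolomorphicBall T W ctr RHist R' μ f) {κ : ℝ} {a : ℕ → ι → ℝ}
    (hmass : ∀ k, ∀ g ∈ W, ∀ (U : C.BgB), ∀ h ∈ closedBall (ctr k g U).2 (RHist k), ∀ X : C.Dom, C.scale X = k → ∀ i,
      ∃ bd : α k i → ℝ, Integrable bd (μ k i h X) ∧
        (∀ᵐ a ∂(μ k i h X), ∀ o ∈ ball (ctr k g U).1 (R' k), ‖f k i h X o a‖ ≤ bd a) ∧
          ∫ a, bd a ∂(μ k i h X) ≤ a k i * Real.exp (-(κ * C.d X))) :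
    TermBound (ballClass ctr ROp RHist) T W κ a := by
  refine termBound_of_opHolomorphic_majorant (termOpHolomorphic_of_ball hroom hball) fun k g hg U q hq X hX i => ?_
  have hq' := Set.mem_prod.1 hq
  have ho : q.1 ∈ ball (ctr k g U).1 (R' k) := mem_ball.2 (lt_of_le_of_lt (mem_closedBall.1 hq'.1) (hroom k))
  obtain ⟨bd, hbdi, hble, hbud⟩ := hmass k g hg U q.2 hq'.2 X hX i
  exact ⟨bd, hbdi, by filter_upwards [hble] with a ha using ha q.1 ho, hbud⟩

end Ball

/-! ## §4 END faces with BOTH species structural (operator: dominated holomorphic integral; history: exp-linear) -/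

section End

variable {C : Carriers} {Op Hist : Type*} [NormedAddCommGroup Op] [NormedSpace ℂ Op] [NormedAddCommGroup Hist]
  [NormedSpace ℂ Hist] {ι : Type*} (M : StepModel C Op Hist) (K : ℕ → (ℕ → ℝ) → C.BgB → Set (Op × Hist))
  (T : ℕ → ι → Op → Hist → C.Dom → ℂ)

/-- **NE5 FROM TERMWISE DATA WITH BOTH SPECIES STRUCTURAL** — the leaf's `ne5_at_of_stepModel_termwise_expLinear_scale_nat`
with its last [analysis] binder `hlineOp : TermOpLineAnalytic K T W` REPLACED by the structural `TermOpHolomorphic K T W μO f 𝒪`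
(§2); the history species structural as before (`TermHistExpLinear K T W μ Φ Λ`).  Remaining binders, all BY NAME and unchanged:
MI-R (`RepresentsA`/`RepresentsB`/`InBase`), the undilated slack `BoxInClass`, the convergent expansion `TermRep` with its
majorants `TermBound`/`TermBudget`, the one-run levels, W1 `OperatorRate`, W4 `InsertionRate`, the insertion structure
`InsAffine`/`InsBlind`/`InsHomog`, W3 `InsScaleBound`, reach R and smallness S; SAME smallness `ω + G·c/(1 − ρ₀) < θ′`, SAME
constant `(G(δ + δ′)/(1 − ρ₀) + B)(θ′ − ω)/(θ′ − (ω + G·c/(1 − ρ₀)))`; conclusion `T4OutputRate.NE5` LITERALLY.  NOT a proof of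
NE5 for Bałaban's step: no binder is instantiated on his objects here. [folklore] -/
theorem ne5_at_of_stepModel_termwise_biStructural_scale_nat {EA : Functional C C.BgA} {EB : Functional C C.BgB}
    {W : Set (ℕ → ℝ)} {a : ℕ → ι → ℝ} {αO : ℕ → ι → Type*} [∀ k i, MeasurableSpace (αO k i)]
    {μO : ∀ k i, Hist → C.Dom → Measure (αO k i)} {f : ∀ k i, Hist → C.Dom → Op → αO k i → ℂ}
    {𝒪 : ℕ → (ℕ → ℝ) → C.BgB → Hist → Set Op} {α : ℕ → ι → Type*} [∀ k i, MeasurableSpace (α k i)]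
    {μ : ∀ k i, Op → C.Dom → Measure (α k i)} {Φ : ∀ k i, Op → C.Dom → α k i → ℂ}
    {Λ : ∀ k i, Op → C.Dom → α k i → (Hist →L[ℂ] ℂ)} {κ G EA₀ E₀ E₁ δ δ' θ θ' c ω ρ₀ B : ℝ} {k₀ : ℕ}
    (hrA : M.RepresentsA EA W) (hrB : M.RepresentsB EB W) (hbase : M.InBase EB W) (hbox : BoxInClass M K W)
    (hrep : TermRep M K T W) (hbd : TermBound K T W κ a) (hbud : TermBudget a G) (hhol : TermOpHolomorphic K T W μO f 𝒪)
    (hexp : TermHistExpLinear K T W μ Φ Λ) (hdA : DecayBound EA W EA₀ κ) (hdB : DecayBound EB W E₀ κ)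
    (hop : M.OperatorRate W δ θ) (hins : M.InsertionRate W κ E₀ δ' θ) (haff : M.InsAffine W) (hblind : M.InsBlind W)
    (hhom : M.InsHomog W) (hunit : M.InsScaleBound W κ E₁ c ω) (hE₁ : 0 < E₁) (hG : 0 ≤ G) (hδ : 0 ≤ δ)
    (hδ' : 0 ≤ δ') (hθ : 0 ≤ θ) (hθθ' : θ ≤ θ') (hθ'1 : θ' ≤ 1) (hc : 0 ≤ c) (hω : 0 < ω) (hρ₀ : ρ₀ < 1)
    (hnear : (δ + δ') * θ ^ k₀ + c * (EA₀ + E₀) / (1 - ω) ≤ ρ₀) (hB : 0 ≤ B) (hfirst : ∀ k < k₀, EA₀ + E₀ ≤ B * θ ^ k)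
    (hsmall : ω + G / (1 - ρ₀) * c < θ') :
    NE5 EA EB W κ θ' ((G / (1 - ρ₀) * δ + G / (1 - ρ₀) * δ' + B) * (θ' - ω) / (θ' - (ω + G / (1 - ρ₀) * c))) :=
  ne5_at_of_stepModel_termwise_expLinear_scale_nat M K T hrA hrB hbase hbox hrep hbd hbud
    (termOpLineAnalytic_of_opHolomorphic hhol) hexp hdA hdB hop hins haff hblind hhom hunit hE₁ hG hδ hδ' hθ hθθ' hθ'1 hc
    hω hρ₀ hnear hB hfirst hsmall

/-- **NE5 FROM BUDGET, TERMWISE DATA AND BOTH SPECIES STRUCTURAL ON THE UNDILATED BALL CLASS** — the leaf's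
`ne5_at_of_stepModel_termwise_expLinear_budget_scale_nat` with `hlineOp` REPLACED by the BALL FORM `TermOpHolomorphicBall T W ctr
RHist R′ μO f` with room `ROp k < R′ k` (§3); everything else BY NAME and unchanged; SAME smallness, SAME constant; conclusion
`T4OutputRate.NE5` LITERALLY. [folklore] -/
theorem ne5_at_of_stepModel_termwise_biStructural_budget_scale_nat {EA : Functional C C.BgA} {EB : Functional C C.BgB}
    {W : Set (ℕ → ℝ)} {ctr : ℕ → (ℕ → ℝ) → C.BgB → Op × Hist} {BOp BHist ROp RHist R' : ℕ → ℝ} {a : ℕ → ι → ℝ}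
    {αO : ℕ → ι → Type*} [∀ k i, MeasurableSpace (αO k i)] {μO : ∀ k i, Hist → C.Dom → Measure (αO k i)}
    {f : ∀ k i, Hist → C.Dom → Op → αO k i → ℂ} {α : ℕ → ι → Type*} [∀ k i, MeasurableSpace (α k i)]
    {μ : ∀ k i, Op → C.Dom → Measure (α k i)} {Φ : ∀ k i, Op → C.Dom → α k i → ℂ}
    {Λ : ∀ k i, Op → C.Dom → α k i → (Hist →L[ℂ] ℂ)} {κ G EA₀ E₀ E₁ δ δ' θ θ' c ω ρ₀ B : ℝ} {k₀ : ℕ}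
    (hrA : M.RepresentsA EA W) (hrB : M.RepresentsB EB W) (hbase : M.InBase EB W) (hbudget : BaseBudget M W ctr BOp BHist)
    (hOp : ∀ k, BOp k + M.rOp k ≤ ROp k) (hHist : ∀ k, BHist k + M.rHist k ≤ RHist k)
    (hrep : TermRep M (ballClass ctr ROp RHist) T W) (hbd : TermBound (ballClass ctr ROp RHist) T W κ a)
    (hbud : TermBudget a G) (hroom : ∀ k, ROp k < R' k) (hball : TermOpHolomorphicBall T W ctr RHist R' μO f)
    (hexp : TermHistExpLinear (ballClass ctr ROp RHist) T W μ Φ Λ) (hdA : DecayBound EA W EA₀ κ)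
    (hdB : DecayBound EB W E₀ κ) (hop : M.OperatorRate W δ θ) (hins : M.InsertionRate W κ E₀ δ' θ)
    (haff : M.InsAffine W) (hblind : M.InsBlind W) (hhom : M.InsHomog W) (hunit : M.InsScaleBound W κ E₁ c ω)
    (hE₁ : 0 < E₁) (hG : 0 ≤ G) (hδ : 0 ≤ δ) (hδ' : 0 ≤ δ') (hθ : 0 ≤ θ) (hθθ' : θ ≤ θ') (hθ'1 : θ' ≤ 1) (hc : 0 ≤ c)
    (hω : 0 < ω) (hρ₀ : ρ₀ < 1) (hnear : (δ + δ') * θ ^ k₀ + c * (EA₀ + E₀) / (1 - ω) ≤ ρ₀) (hB : 0 ≤ B)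
    (hfirst : ∀ k < k₀, EA₀ + E₀ ≤ B * θ ^ k) (hsmall : ω + G / (1 - ρ₀) * c < θ') :
    NE5 EA EB W κ θ' ((G / (1 - ρ₀) * δ + G / (1 - ρ₀) * δ' + B) * (θ' - ω) / (θ' - (ω + G / (1 - ρ₀) * c))) :=
  ne5_at_of_stepModel_termwise_expLinear_budget_scale_nat M T hrA hrB hbase hbudget hOp hHist hrep hbd hbud
    (termOpLineAnalytic_of_ball hroom hball) hexp hdA hdB hop hins haff hblind hhom hunit hE₁ hG hδ hδ' hθ hθθ' hθ'1 hc hω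
    hρ₀ hnear hB hfirst hsmall

end End

/-! ## §5 The output-level face: W2-op in its original currency for outputs that are dominated holomorphic integrals -/

section OutputLevel

variable {C : Carriers} {Op Hist : Type*} [NormedAddCommGroup Op] [NormedSpace ℂ Op] [NormedAddCommGroup Hist]
  [NormedSpace ℂ Hist] (M : StepModel C Op Hist)

/-- STRUCTURAL SHAPE `OutOpHolomorphic M W κ G μ f 𝒪` (output level, no series; [analysis]): at every base point `p`, step-`k`
domain `X` and history datum `h` of the history ball, the OUTPUT `o ↦ M.Out k o h X` is, on an operator domain `𝒪 k g U p h`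
containing the closed operator ball of radius `rOp k` around `p.1`, the integral of an integrand a.e.-strongly measurable in `a`,
holomorphic in `o` for a.e. `a`, locally uniformly dominated, and dominated on the closed operator ball by ONE majorant of mass
`≤ G·e^{−κd(X)}`. [folklore] -/
def OutOpHolomorphic (W : Set (ℕ → ℝ)) (κ G : ℝ) {α : ℕ → Type*} [∀ k, MeasurableSpace (α k)]
    (μ : ∀ k, Hist → C.Dom → Measure (α k)) (f : ∀ k, Hist → C.Dom → Op → α k → ℂ)
    (𝒪 : ℕ → (ℕ → ℝ) → C.BgB → Op × Hist → Hist → Set Op) : Prop :=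
  ∀ k, ∀ g ∈ W, ∀ (U : C.BgB) (p : Op × Hist), p ∈ M.Base k g U → ∀ X : C.Dom, C.scale X = k →
    ∀ h ∈ closedBall p.2 (M.rHist k),
      closedBall p.1 (M.rOp k) ⊆ 𝒪 k g U p h ∧
      (∀ o ∈ 𝒪 k g U p h, AEStronglyMeasurable (f k h X o) (μ k h X)) ∧
      (∀ᵐ a ∂(μ k h X), DifferentiableOn ℂ (fun o => f k h X o a) (𝒪 k g U p h)) ∧
      (∀ o₀ ∈ 𝒪 k g U p h, ∃ R : ℝ, 0 < R ∧ ball o₀ R ⊆ 𝒪 k g U p h ∧ ∃ bound : α k → ℝ,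
          Integrable bound (μ k h X) ∧ ∀ᵐ a ∂(μ k h X), ∀ o ∈ ball o₀ R, ‖f k h X o a‖ ≤ bound a) ∧
      (∃ bd : α k → ℝ, Integrable bd (μ k h X) ∧
          (∀ᵐ a ∂(μ k h X), ∀ o ∈ closedBall p.1 (M.rOp k), ‖f k h X o a‖ ≤ bd a) ∧
            ∫ a, bd a ∂(μ k h X) ≤ G * Real.exp (-(κ * C.d X))) ∧
      (∀ o ∈ 𝒪 k g U p h, M.Out k o h X = ∫ a, f k h X o a ∂(μ k h X))

variable {M}

/-- **OUTPUT-LEVEL STRUCTURE ⟹ W2-op IN ITS ORIGINAL CURRENCY**: `OutOpHolomorphic M W κ G μ f 𝒪 ⟹ StepModel.OpFibreEnvelope M W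
κ G` — along every operator line `p.1 + ζu`, `|ζ| ≤ 1`, `‖u‖ ≤ rOp k`, the output is complex differentiable on the closed unit disc
(§1, the line stays in the closed operator ball, inside the holomorphy domain) and bounded by the majorant's mass. [folklore] -/
theorem opFibreEnvelope_of_outHolomorphic {W : Set (ℕ → ℝ)} {κ G : ℝ} {α : ℕ → Type*} [∀ k, MeasurableSpace (α k)]
    {μ : ∀ k, Hist → C.Dom → Measure (α k)} {f : ∀ k, Hist → C.Dom → Op → α k → ℂ}
    {𝒪 : ℕ → (ℕ → ℝ) → C.BgB → Op × Hist → Hist → Set Op} (hout : OutOpHolomorphic M W κ G μ f 𝒪) :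
    M.OpFibreEnvelope W κ G := by
  intro k g hg U p hp X hX h hh u hu
  obtain ⟨hsub, hmeas, hdiff, hdom, ⟨bd, hbdi, hble, hbud⟩, hrepr⟩ := hout k g hg U p hp X hX h hh
  have hline : MapsTo (fun ζ : ℂ => p.1 + ζ • u) (closedBall (0 : ℂ) 1) (closedBall p.1 (M.rOp k)) := by
    intro ζ hζ
    rw [mem_closedBall, dist_zero_right] at hζ
    rw [mem_closedBall, dist_eq_norm, add_sub_cancel_left, norm_smul]
    calc ‖ζ‖ * ‖u‖ ≤ 1 * M.rOp k := mul_le_mul hζ hu (norm_nonneg _) zero_le_one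
      _ = M.rOp k := one_mul _
  have hS : MapsTo (fun ζ : ℂ => p.1 + ζ • u) (closedBall (0 : ℂ) 1) (𝒪 k g U p h) := fun ζ hζ => hsub (hline hζ)
  refine ⟨(differentiableOn_integral_lineMap_of_dominated hmeas hdiff hdom p.1 u hS).congr fun ζ hζ => hrepr _ (hS hζ),
    fun ζ hζ => ?_⟩
  rw [hrepr _ (hS hζ)]
  exact (norm_integral_le_of_majorant hbdi (by filter_upwards [hble] with a ha using ha _ (hline hζ))).trans hbud

end OutputLevel

end Summit.QuantumFields.BalabanUV.T4Continuum.OutputRateOpHolomorphic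

end
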